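import Summits.QuantumFields.BalabanUV.Beta.TentQuasiReconstructionTorus

/-!
# Beta / TentQuasiReconstructionScaling — «γ₀ ABSOLUTE» READ OFF: the E-I3 instance at U = 1 in the SCALED regime
# μ = a/n² (mass a on the block scale), ramp width w ≍ n/ν — the coarse operator of the free massive Laplacian satisfies
# **Re B*(Q̃A⁻¹Q̃ᵀ)B ≥ γ₀(ν, a)·(n²/n^ν)·‖B‖² with γ₀(ν, a) = (2 − e^{1/2})²/(6^ν(a + 384ν³))** independent of the block size n
# and of the number of blocks m (unit `b2b-balaban-beta-d4-p2`, GEN 5, MODEL crew; corollary of `TentQuasiReconstructionTorus`)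

HONEST FRAMING: discharging `BetaPertH` makes Bałaban's UV stability UNCONDITIONAL — NOT the continuum limit, NOT the
Clay problem.  HONEST DEPENDENCY (verbatim): «continuum YM on T⁴ ⇐ BetaPertH ∧ nine spine estimates (0/9 proved);
BetaPertH ⇐ (D1) ∧ (D4) ∧ CAP+tail; G-an2-4 gates asym, D1 and NE2/3/4.»  THIS MODULE DISCHARGES NOTHING of `BetaPertH`,
asserts NOTHING printed and cites nothing as a fact (ABSOLUTE RULE): [folklore] real arithmetic about a MODEL (free
Laplacian, U = 1); SHAPE located at [B6] = `Balaban1984PropagatorsII` (2.76) p. 236 «γ₀ is a positive, absolute constant».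
The factor n²/n^ν = n^{2−ν} is the lattice-unit scaling of a coarse Green's function of ν-dimensional blocks of side n (the
dimensionless statement is the n-independence of γ₀).  No class change on row D4 or G-B9-15 (width 0; D4 DISCHARGE NO DATE);
NOT BetaPertH, NOT continuum, NOT Clay.

CONTENT.  `pow_ratio_le_exp_half` ((1 + 2w/n)^ν ≤ e^{1/2} when 4νw ≤ n); `energyConst_le_scaled`
(E ≤ 6^ν(a + 384ν³)·n^ν/n² when μ = a/n², 4νw ≤ n ≤ 8νw); `gamma0`; **`coarse_coercive_scaled`**.
-/

namespace Summit.QuantumFields.BalabanUV.Beta.TentQuasiReconstructionScaling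

open Finset Matrix
open scoped BigOperators
open Summit.QuantumFields.BalabanUV.Beta.TentQuasiReconstruction1D
open Summit.QuantumFields.BalabanUV.Beta.TentQuasiReconstructionLaplacian
open Summit.QuantumFields.BalabanUV.Beta.TentQuasiReconstructionTorus
open Summit.QuantumFields.BalabanUV.Beta.AccretiveCombesThomasSandwich (sandwich)
open Literature.MathematicalPhysics.QuantumFieldTheory.Balaban1983to89.B5Prop11Lower (nsq nsq_nonneg)

noncomputable section

/-- **The mass-matrix ratio is ≤ e^{1/2}** when the ramps are short: `4νw ≤ n ⇒ (1 + 2w/n)^ν ≤ e^{1/2}`. [folklore] -/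
theorem pow_ratio_le_exp_half {ν n w : ℕ} (hν : 1 ≤ ν) (hn : 1 ≤ n) (h4 : 4 * ν * w ≤ n) :
    (1 + 2 * (w : ℝ) / n) ^ ν ≤ Real.exp (1 / 2) := by
  have hn0 : (0 : ℝ) < n := by exact_mod_cast hn
  have hν0 : (0 : ℝ) < ν := by exact_mod_cast hν
  have h4' : 4 * (ν : ℝ) * w ≤ n := by exact_mod_cast h4
  have hq : 2 * (w : ℝ) / n ≤ 1 / (2 * ν) := by
    rw [div_le_div_iff₀ hn0 (by positivity)]; nlinarith
  have h1 : 1 + 2 * (w : ℝ) / n ≤ Real.exp (1 / (2 * ν)) := by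
    have := Real.add_one_le_exp (1 / (2 * (ν : ℝ)))
    linarith
  have h0 : 0 ≤ 1 + 2 * (w : ℝ) / n := by positivity
  calc (1 + 2 * (w : ℝ) / n) ^ ν ≤ Real.exp (1 / (2 * ν)) ^ ν := pow_le_pow_left₀ h0 h1 ν
    _ = Real.exp (1 / 2) := by rw [← Real.exp_nat_mul]; congr 1; field_simp

/-- MODEL bookkeeping: **the absolute constant** γ₀(ν, a) = (2 − e^{1/2})²/(6^ν(a + 384ν³)). [folklore] -/
def gamma0 (ν : ℕ) (a : ℝ) : ℝ := (2 - Real.exp (1 / 2)) ^ 2 / ((6 : ℝ) ^ ν * (a + 384 * (ν : ℝ) ^ 3))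

/-- γ₀ > 0 for a > 0. [folklore] -/
theorem gamma0_pos (ν : ℕ) {a : ℝ} (ha : 0 < a) : 0 < gamma0 ν a := by
  unfold gamma0
  have he : Real.exp (1 / 2) < 2 := by
    by_contra h
    push Not at h
    have h2 : Real.exp (1 / 2) * Real.exp (1 / 2) = Real.exp 1 := by rw [← Real.exp_add]; norm_num
    have h4 : (4 : ℝ) ≤ Real.exp 1 := by nlinarith [Real.exp_pos (1 / 2 : ℝ)]
    linarith [Real.exp_one_lt_d9]
  have h2 : 0 < (2 - Real.exp (1 / 2)) ^ 2 := by positivity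
  positivity

/-- **The energy constant in the scaled regime**: μ = a/n², 4νw ≤ n ≤ 8νw, 1 ≤ ν ⇒
`energyConst ν n w (a/n²) ≤ 6^ν(a + 384ν³)·(n^ν/n²)`. [folklore] -/
theorem energyConst_le_scaled {ν n w : ℕ} (hν : 1 ≤ ν) (hw : 1 ≤ w) (h4 : 4 * ν * w ≤ n) (h8 : n ≤ 8 * ν * w) {a : ℝ}
    (ha : 0 ≤ a) :
    energyConst ν n w (a / (n : ℝ) ^ 2) ≤ (6 : ℝ) ^ ν * (a + 384 * (ν : ℝ) ^ 3) * ((n : ℝ) ^ ν / (n : ℝ) ^ 2) := by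
  obtain ⟨k, rfl⟩ : ∃ k, ν = k + 1 := ⟨ν - 1, by omega⟩
  have hw0 : (0 : ℝ) < w := by exact_mod_cast hw
  have hn1 : 1 ≤ n := le_trans (by nlinarith) h4
  have hn0 : (0 : ℝ) < n := by exact_mod_cast hn1
  have h4' : 4 * ((k : ℝ) + 1) * w ≤ n := by exact_mod_cast (by simpa using h4)
  have h8' : (n : ℝ) ≤ 8 * ((k : ℝ) + 1) * w := by exact_mod_cast (by simpa using h8)
  have hk0 : (0 : ℝ) ≤ k := Nat.cast_nonneg k
  -- elementary bounds
  have hb1 : (n : ℝ) + 2 * w ≤ 2 * n := by nlinarith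
  have hb2 : 6 / (w : ℝ) ≤ 48 * ((k : ℝ) + 1) / n := by
    rw [div_le_div_iff₀ hw0 hn0]; nlinarith
  have hb3 : 6 * (n : ℝ) / w ≤ 48 * ((k : ℝ) + 1) := by
    rw [div_le_iff₀ hw0]; nlinarith
  have hp1 : ((n : ℝ) + 2 * w) ^ (k + 1) ≤ (2 * n) ^ (k + 1) := pow_le_pow_left₀ (by positivity) hb1 _
  have hp2 : ((n : ℝ) + 2 * w) ^ k ≤ (2 * n) ^ k := pow_le_pow_left₀ (by positivity) hb1 _
  unfold energyConst
  simp only [Nat.add_sub_cancel, Nat.cast_add, Nat.cast_one]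
  have t1 : a / (n : ℝ) ^ 2 * 3 ^ (k + 1) * ((n : ℝ) + 2 * w) ^ (k + 1) ≤
      a / (n : ℝ) ^ 2 * 3 ^ (k + 1) * (2 * n) ^ (k + 1) :=
    mul_le_mul_of_nonneg_left hp1 (by positivity)
  have t2 : ((k : ℝ) + 1) * (6 / w * 3 ^ k) * (6 * n / w * ((n : ℝ) + 2 * w) ^ k) ≤
      ((k : ℝ) + 1) * (48 * ((k : ℝ) + 1) / n * 3 ^ k) * (48 * ((k : ℝ) + 1) * (2 * n) ^ k) := by
    have a1 : 6 / (w : ℝ) * 3 ^ k ≤ 48 * ((k : ℝ) + 1) / n * 3 ^ k := mul_le_mul_of_nonneg_right hb2 (by positivity)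
    have a2 : 6 * (n : ℝ) / w * ((n : ℝ) + 2 * w) ^ k ≤ 48 * ((k : ℝ) + 1) * (2 * n) ^ k :=
      mul_le_mul hb3 hp2 (by positivity) (by positivity)
    exact mul_le_mul (mul_le_mul_of_nonneg_left a1 (by positivity)) a2 (by positivity) (by positivity)
  refine (add_le_add t1 t2).trans (le_of_eq ?_)
  have hn' : (n : ℝ) ≠ 0 := hn0.ne'
  have h6 : (6 : ℝ) ^ (k + 1) = 2 ^ (k + 1) * 3 ^ (k + 1) := by rw [← mul_pow]; norm_num
  rw [h6, mul_pow]
  field_simp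
  ring

/-- **E-I3 AT U = 1, SCALED FORM (γ₀ ABSOLUTE)**: on the torus (ℤ/m × Fin n)^ν (m ≥ 3, ν ≥ 1) with A = (a/n²)·1 +
Σ_i D_iᴴD_i (a > 0), block means Q̃ and any ramp width with 4νw ≤ n ≤ 8νw (w ≥ 1):
`γ₀(ν, a)·(n²/n^ν)·‖B‖² ≤ Re B*(Q̃A⁻¹Q̃ᵀ)B`, γ₀(ν, a) = (2 − e^{1/2})²/(6^ν(a + 384ν³)) — independent of n and m. [folklore] -/
theorem coarse_coercive_scaled {ν m n : ℕ} [NeZero m] [NeZero n] (hν : 1 ≤ ν) (hm : 3 ≤ m) {w : ℕ} (hw : 1 ≤ w)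
    (h4 : 4 * ν * w ≤ n) (h8 : n ≤ 8 * ν * w) {a : ℝ} (ha : 0 < a) (B : Blk ν m → ℂ) :
    gamma0 ν a * ((n : ℝ) ^ 2 / (n : ℝ) ^ ν) * nsq B ≤
      (star B ⬝ᵥ (sandwich (lapA ν m n (a / (n : ℝ) ^ 2)) (qT n) *ᵥ B)).re := by
  have hn1 : 1 ≤ n := Nat.one_le_iff_ne_zero.mpr (NeZero.ne n)
  have hn0 : (0 : ℝ) < n := by exact_mod_cast hn1
  have hwn : w ≤ n := le_trans (by nlinarith) h4
  have hμ : 0 < a / (n : ℝ) ^ 2 := by positivity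
  have hq : (1 + 2 * (w : ℝ) / n) ^ ν ≤ Real.exp (1 / 2) := pow_ratio_le_exp_half hν hn1 h4
  have he : Real.exp (1 / 2) < 2 := by
    by_contra h
    push Not at h
    have h2 : Real.exp (1 / 2) * Real.exp (1 / 2) = Real.exp 1 := by rw [← Real.exp_add]; norm_num
    have h4 : (4 : ℝ) ≤ Real.exp 1 := by nlinarith [Real.exp_pos (1 / 2 : ℝ)]
    linarith [Real.exp_one_lt_d9]
  have hσ : (1 + 2 * (w : ℝ) / n) ^ ν < 2 := lt_of_le_of_lt hq he
  have hmain := coarse_coercive_tent_torus (ν := ν) (m := m) (n := n) hm hw hwn hμ hσ B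
  -- compare the constants
  have hE := energyConst_le_scaled hν hw h4 h8 ha.le
  have hE0 : 0 < energyConst ν n w (a / (n : ℝ) ^ 2) := by
    unfold energyConst
    have : (0 : ℝ) < a / (n : ℝ) ^ 2 * 3 ^ ν * ((n : ℝ) + 2 * w) ^ ν := by positivity
    have : (0 : ℝ) ≤ ν * (6 / w * (3 : ℝ) ^ (ν - 1)) * (6 * n / w * ((n : ℝ) + 2 * w) ^ (ν - 1)) := by positivity
    linarith
  have hc : (2 - Real.exp (1 / 2)) ^ 2 ≤ (2 - (1 + 2 * (w : ℝ) / n) ^ ν) ^ 2 :=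
    pow_le_pow_left₀ (by linarith) (by linarith) 2
  have hK : gamma0 ν a * ((n : ℝ) ^ 2 / (n : ℝ) ^ ν) ≤
      (2 - (1 + 2 * (w : ℝ) / n) ^ ν) ^ 2 / energyConst ν n w (a / (n : ℝ) ^ 2) := by
    have hden : 0 < (6 : ℝ) ^ ν * (a + 384 * (ν : ℝ) ^ 3) * ((n : ℝ) ^ ν / (n : ℝ) ^ 2) := by positivity
    calc gamma0 ν a * ((n : ℝ) ^ 2 / (n : ℝ) ^ ν)
        = (2 - Real.exp (1 / 2)) ^ 2 / ((6 : ℝ) ^ ν * (a + 384 * (ν : ℝ) ^ 3) * ((n : ℝ) ^ ν / (n : ℝ) ^ 2)) := by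
          unfold gamma0; field_simp
      _ ≤ (2 - Real.exp (1 / 2)) ^ 2 / energyConst ν n w (a / (n : ℝ) ^ 2) :=
          div_le_div_of_nonneg_left (by positivity) hE0 hE
      _ ≤ (2 - (1 + 2 * (w : ℝ) / n) ^ ν) ^ 2 / energyConst ν n w (a / (n : ℝ) ^ 2) :=
          div_le_div_of_nonneg_right hc hE0.le
  exact le_trans (mul_le_mul_of_nonneg_right hK (nsq_nonneg B)) hmain

end

end Summit.QuantumFields.BalabanUV.Beta.TentQuasiReconstructionScaling
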